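import Summits.QuantumFields.YangMills.Theorems.FradkinShenkerFlowPoincareToClusteringHeatBath

/-!
# The random-scan heat bath: `L²` contraction from the uniform Poincaré inequality

Route `FradkinShenkerFlow` of `YangMills`, support item `stmt-QuantumFields-9444`
(`Summit.QuantumFields.YangMills.Theses.FradkinShenkerFlow.PoincareToClustering`, UP ⇒ EC).

For the torus Wilson measure `μ = wilsonMeasure ρ β` and the single-link heat-bath operators
`E_ℓ = hbOp ρ β ℓ` (files `…Defs`, `…HeatBath`), the **random-scan heat-bath operator** is
`K h = |E|⁻¹ ∑_ℓ E_ℓ h` (`scanOp`, file `…Defs`). This file proves: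

* `scanOp` preserves measurability, sup bounds and the `μ`-integral (DLR);
* `integral_hbOp_sq`: `∫ (E_ℓ h)² dμ = ∫ h · E_ℓ h dμ` (pull-out + DLR), and the Dirichlet-form
  identity `integral_integral_sq_sub`:
  `∫∫ (h(U) − h(U[ℓ↦g]))² dν_ℓ^U dμ = 2 ∫ h² dμ − 2 ∫ h E_ℓ h dμ`;
* `integral_sq_scanOp_le` — the **spectral-gap step**: if `μ` satisfies the heat-bath Poincaré
  inequality `Var_μ(F) ≤ C ∑_ℓ ∫∫ (F(U) − F(U[ℓ↦g]))² dν_ℓ^U dμ` for all bounded measurable `F`,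
  then for every bounded measurable `h` with `∫ h dμ = 0`,
  `∫ (K h)² dμ ≤ (1 − (2 C |E|)⁻¹) ∫ h² dμ`
  (Jensen on the average over links, `‖E_ℓ h‖² = ⟨h, E_ℓ h⟩`, and the Poincaré inequality read
  as `‖h‖² ≤ 2C ∑_ℓ (‖h‖² − ⟨h, E_ℓ h⟩)`);
* `scanIter` — the iterates `K^j h`, with measurability, bounds, centring and the geometric decay
  `∫ (K^j h)² dμ ≤ (1 − (2 C |E|)⁻¹)^j ∫ h² dμ`.

References: F. Martinelli, LNM 1717 (1999), §3 (Poincaré inequality = spectral gap of the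
heat-bath dynamics); T. Liggett, *Interacting Particle Systems* (1985/2005), Ch. I §4 and IV.
-/

noncomputable section

open MeasureTheory ProbabilityTheory
open Literature.MathematicalPhysics.QuantumFieldTheory

namespace Summit.QuantumFields.YangMills.Theorems.PoincareClustering

/-- `|a| ≤ M → |a ^ 2| ≤ M ^ 2`. [folklore] -/
theorem abs_sq_le_sq {a M : ℝ} (h : |a| ≤ M) : |a ^ 2| ≤ M ^ 2 := by
  rw [abs_pow]
  exact pow_le_pow_left₀ (abs_nonneg _) h 2

/-- `|a| ≤ M → |b| ≤ M' → |a * b| ≤ M * M'`. [folklore] -/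
theorem abs_mul_le_mul {a b M M' : ℝ} (ha : |a| ≤ M) (hb : |b| ≤ M') : |a * b| ≤ M * M' := by
  rw [abs_mul]
  exact mul_le_mul ha hb (abs_nonneg _) ((abs_nonneg _).trans ha)

section Gap

variable {d L N : ℕ} {G : Type*} [Group G] [TopologicalSpace G] [IsTopologicalGroup G]
  [CompactSpace G] [MeasurableSpace G] [BorelSpace G] [NeZero L]
  (ρ : G →* Matrix (Fin N) (Fin N) ℂ) (β : ℝ)

variable [SecondCountableTopology G]

/-- `K h` is measurable. [folklore] -/
theorem measurable_scanOp (hρ : Continuous ρ) {h : GaugeConfig d L G → ℝ} (hh : Measurable h) :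
    Measurable (scanOp ρ β h) := by
  unfold scanOp
  exact (Finset.measurable_sum _ fun ℓ _ => measurable_hbOp ρ β hρ ℓ hh).const_mul _

/-- Sup bound: `|K h| ≤ M` if `|h| ≤ M`. [folklore] -/
theorem abs_scanOp_le (hρ : Continuous ρ) {h : GaugeConfig d L G → ℝ} {M : ℝ}
    (hM : ∀ V, |h V| ≤ M) (U : GaugeConfig d L G) : |scanOp ρ β h U| ≤ M := by
  have hM0 : 0 ≤ M := (abs_nonneg _).trans (hM U)
  unfold scanOp
  rw [abs_mul, abs_inv, Nat.abs_cast]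
  rcases Nat.eq_zero_or_pos (Fintype.card (Edge d L)) with hc | hc
  · simp [hc, hM0]
  · have hc' : (Fintype.card (Edge d L) : ℝ) ≠ 0 := by exact_mod_cast hc.ne'
    calc (Fintype.card (Edge d L) : ℝ)⁻¹ * |∑ ℓ, hbOp ρ β ℓ h U|
        ≤ (Fintype.card (Edge d L) : ℝ)⁻¹ * ∑ ℓ, |hbOp ρ β ℓ h U| :=
          mul_le_mul_of_nonneg_left (Finset.abs_sum_le_sum_abs _ _) (by positivity)
      _ ≤ (Fintype.card (Edge d L) : ℝ)⁻¹ * ∑ _ℓ : Edge d L, M :=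
          mul_le_mul_of_nonneg_left (Finset.sum_le_sum fun ℓ _ => abs_hbOp_le ρ β hρ ℓ hM U)
            (by positivity)
      _ = M := by
          rw [Finset.sum_const, Finset.card_univ, nsmul_eq_mul, ← mul_assoc, inv_mul_cancel₀ hc',
            one_mul]

/-- DLR for the random scan: `∫ K h dμ = ∫ h dμ`. [folklore] -/
theorem integral_scanOp [NeZero d] (hρ : Continuous ρ) {h : GaugeConfig d L G → ℝ}
    (hh : Measurable h) {M : ℝ} (hM : ∀ V, |h V| ≤ M) :
    ∫ U, scanOp ρ β h U ∂(wilsonMeasure (d := d) (L := L) ρ β) =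
      ∫ U, h U ∂(wilsonMeasure (d := d) (L := L) ρ β) := by
  haveI := isProbabilityMeasure_wilsonMeasure (d := d) (L := L) ρ hρ β
  unfold scanOp
  rw [integral_const_mul, integral_finsetSum _ (fun ℓ _ =>
    integrable_of_measurable_of_abs_le (measurable_hbOp ρ β hρ ℓ hh) (abs_hbOp_le ρ β hρ ℓ hM))]
  simp only [integral_hbOp_wilsonMeasure ρ β hρ _ hh hM]
  rw [Finset.sum_const, Finset.card_univ, nsmul_eq_mul, ← mul_assoc, inv_mul_cancel₀
    (Nat.cast_ne_zero.2 Fintype.card_ne_zero), one_mul]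

/-- `∫ (E_ℓ h)² dμ = ∫ h · E_ℓ h dμ`: `E_ℓ` is an orthogonal projection in `L²(μ)`
(pull-out property and DLR). [folklore] -/
theorem integral_hbOp_sq (hρ : Continuous ρ) (ℓ : Edge d L) {h : GaugeConfig d L G → ℝ}
    (hh : Measurable h) {M : ℝ} (hM : ∀ V, |h V| ≤ M) :
    ∫ U, (hbOp ρ β ℓ h U) ^ 2 ∂(wilsonMeasure (d := d) (L := L) ρ β) =
      ∫ U, h U * hbOp ρ β ℓ h U ∂(wilsonMeasure (d := d) (L := L) ρ β) := by
  have hk : ∀ U g, hbOp ρ β ℓ h (Function.update U ℓ g) = hbOp ρ β ℓ h U := fun U g =>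
    hbOp_update ρ β ℓ h U g
  have hpull : ∀ U, hbOp ρ β ℓ (fun V => hbOp ρ β ℓ h V * h V) U =
      hbOp ρ β ℓ h U * hbOp ρ β ℓ h U := fun U => hbOp_mul_left ρ β ℓ hk U
  have hmeas : Measurable fun V => hbOp ρ β ℓ h V * h V := (measurable_hbOp ρ β hρ ℓ hh).mul hh
  have hbd : ∀ V, |hbOp ρ β ℓ h V * h V| ≤ M * M := fun V =>
    abs_mul_le_mul (abs_hbOp_le ρ β hρ ℓ hM V) (hM V)
  calc ∫ U, (hbOp ρ β ℓ h U) ^ 2 ∂(wilsonMeasure (d := d) (L := L) ρ β)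
      = ∫ U, hbOp ρ β ℓ (fun V => hbOp ρ β ℓ h V * h V) U ∂(wilsonMeasure (d := d) (L := L) ρ β) :=
        integral_congr_ae (ae_of_all _ fun U => show (hbOp ρ β ℓ h U) ^ 2 = _ by rw [hpull, sq])
    _ = ∫ U, hbOp ρ β ℓ h U * h U ∂(wilsonMeasure (d := d) (L := L) ρ β) :=
        integral_hbOp_wilsonMeasure ρ β hρ ℓ hmeas hbd
    _ = _ := integral_congr_ae (ae_of_all _ fun U => mul_comm _ _)

/-- The inner heat-bath integral of the Dirichlet form, expanded:
`∫ (h(U) − h(U[ℓ↦g]))² dν_ℓ^U(g) = h(U)² − 2 h(U) E_ℓ h(U) + E_ℓ(h²)(U)`. [folklore] -/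
theorem integral_sq_sub_hbLaw (hρ : Continuous ρ) (ℓ : Edge d L) {h : GaugeConfig d L G → ℝ}
    (hh : Measurable h) {M : ℝ} (hM : ∀ V, |h V| ≤ M) (U : GaugeConfig d L G) :
    ∫ g, (h U - h (Function.update U ℓ g)) ^ 2 ∂(hbLaw ρ β ℓ U) =
      (h U) ^ 2 - 2 * (h U * hbOp ρ β ℓ h U) + hbOp ρ β ℓ (fun V => (h V) ^ 2) U := by
  haveI := isProbabilityMeasure_hbLaw ρ β hρ ℓ U
  have h1 : Integrable (fun g => h (Function.update U ℓ g)) (hbLaw ρ β ℓ U) :=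
    integrable_comp_update ρ β hρ ℓ U hh hM
  have h2 : Integrable (fun g => (h (Function.update U ℓ g)) ^ 2) (hbLaw ρ β ℓ U) :=
    integrable_comp_update ρ β hρ ℓ U (h := fun V => (h V) ^ 2) (hh.pow_const 2)
      (fun V => abs_sq_le_sq (hM V))
  have h3 : Integrable (fun g => 2 * h U * h (Function.update U ℓ g)) (hbLaw ρ β ℓ U) :=
    h1.const_mul (2 * h U)
  have h4 : Integrable (fun g => (h U) ^ 2 - 2 * h U * h (Function.update U ℓ g)) (hbLaw ρ β ℓ U) :=
    (integrable_const _).sub h3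
  have e1 : ∫ g, (h U - h (Function.update U ℓ g)) ^ 2 ∂(hbLaw ρ β ℓ U) =
      ∫ g, ((h U) ^ 2 - 2 * h U * h (Function.update U ℓ g) + (h (Function.update U ℓ g)) ^ 2)
        ∂(hbLaw ρ β ℓ U) :=
    integral_congr_ae (ae_of_all _ fun g => by ring)
  have e4 : ∫ _g : G, (h U) ^ 2 ∂(hbLaw ρ β ℓ U) = (h U) ^ 2 := by
    rw [integral_const, probReal_univ, one_smul]
  rw [e1, integral_add h4 h2, integral_sub (integrable_const _) h3, e4, integral_const_mul]
  simp only [hbOp]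
  ring

/-- **The heat-bath Dirichlet form in spectral form**:
`∫∫ (h(U) − h(U[ℓ↦g]))² dν_ℓ^U(g) dμ(U) = 2 ∫ h² dμ − 2 ∫ h E_ℓ h dμ` (DLR applied to `h²`)
(Martinelli 1999 §3, `ℰ(f,f) = ∑ ⟨f, (1 − E_ℓ) f⟩`). [folklore] -/
theorem integral_integral_sq_sub (hρ : Continuous ρ) (ℓ : Edge d L) {h : GaugeConfig d L G → ℝ}
    (hh : Measurable h) {M : ℝ} (hM : ∀ V, |h V| ≤ M) :
    ∫ U, ∫ g, (h U - h (Function.update U ℓ g)) ^ 2 ∂(hbLaw ρ β ℓ U)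
        ∂(wilsonMeasure (d := d) (L := L) ρ β) =
      2 * ∫ U, (h U) ^ 2 ∂(wilsonMeasure (d := d) (L := L) ρ β) -
        2 * ∫ U, h U * hbOp ρ β ℓ h U ∂(wilsonMeasure (d := d) (L := L) ρ β) := by
  haveI := isProbabilityMeasure_wilsonMeasure (d := d) (L := L) ρ hρ β
  have hsqm : Measurable fun V => (h V) ^ 2 := hh.pow_const 2
  have hsqb : ∀ V, |(h V) ^ 2| ≤ M ^ 2 := fun V => abs_sq_le_sq (hM V)
  have i1 : Integrable (fun U => (h U) ^ 2) (wilsonMeasure (d := d) (L := L) ρ β) :=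
    integrable_of_measurable_of_abs_le hsqm hsqb
  have i2 : Integrable (fun U => h U * hbOp ρ β ℓ h U) (wilsonMeasure (d := d) (L := L) ρ β) :=
    integrable_of_measurable_of_abs_le (hh.mul (measurable_hbOp ρ β hρ ℓ hh))
      (fun V => abs_mul_le_mul (hM V) (abs_hbOp_le ρ β hρ ℓ hM V))
  have i3 : Integrable (fun U => hbOp ρ β ℓ (fun V => (h V) ^ 2) U)
      (wilsonMeasure (d := d) (L := L) ρ β) :=
    integrable_of_measurable_of_abs_le (measurable_hbOp ρ β hρ ℓ hsqm) (abs_hbOp_le ρ β hρ ℓ hsqb)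
  have i4 : Integrable (fun U => 2 * (h U * hbOp ρ β ℓ h U)) (wilsonMeasure (d := d) (L := L) ρ β) :=
    i2.const_mul 2
  have i5 : Integrable (fun U => (h U) ^ 2 - 2 * (h U * hbOp ρ β ℓ h U))
      (wilsonMeasure (d := d) (L := L) ρ β) := i1.sub i4
  simp only [integral_sq_sub_hbLaw ρ β hρ ℓ hh hM]
  rw [integral_add i5 i3, integral_sub i1 i4, integral_const_mul,
    integral_hbOp_wilsonMeasure ρ β hρ ℓ hsqm hsqb]
  ring

/-- **The spectral-gap step** (Poincaré inequality ⇒ `L²` contraction of the random scan):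
if the torus Wilson measure satisfies the single-link heat-bath Poincaré inequality with
constant `C > 0` for all bounded measurable `F`, then `∫ (K h)² dμ ≤ (1 − (2C|E|)⁻¹) ∫ h² dμ` for
every bounded measurable `h` with `∫ h dμ = 0` (Martinelli 1999, Thm. 3.x: gap of the heat-bath
dynamics = inverse Poincaré constant; discrete-time form via Jensen on the uniform link average
and `‖E_ℓ h‖² = ⟨h, E_ℓ h⟩`). [folklore] -/
theorem integral_sq_scanOp_le [NeZero d] (hρ : Continuous ρ) {C : ℝ} (hC : 0 < C)
    (hP : ∀ F : GaugeConfig d L G → ℝ, Measurable F → (∃ M : ℝ, ∀ U, |F U| ≤ M) →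
      variance F (wilsonMeasure (d := d) (L := L) ρ β) ≤
        C * ∑ ℓ : Edge d L, ∫ U, ∫ g, (F U - F (Function.update U ℓ g)) ^ 2 ∂(hbLaw ρ β ℓ U)
          ∂(wilsonMeasure (d := d) (L := L) ρ β))
    {h : GaugeConfig d L G → ℝ} (hh : Measurable h) {M : ℝ} (hM : ∀ V, |h V| ≤ M)
    (h0 : ∫ U, h U ∂(wilsonMeasure (d := d) (L := L) ρ β) = 0) :
    ∫ U, (scanOp ρ β h U) ^ 2 ∂(wilsonMeasure (d := d) (L := L) ρ β) ≤
      (1 - (2 * C * Fintype.card (Edge d L))⁻¹) *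
        ∫ U, (h U) ^ 2 ∂(wilsonMeasure (d := d) (L := L) ρ β) := by
  haveI := isProbabilityMeasure_wilsonMeasure (d := d) (L := L) ρ hρ β
  have hn0 : (0 : ℝ) < Fintype.card (Edge d L) := by exact_mod_cast Fintype.card_pos
  -- (1) Jensen, pointwise
  have hJ : ∀ U, (scanOp ρ β h U) ^ 2 ≤
      (Fintype.card (Edge d L) : ℝ)⁻¹ * ∑ ℓ, (hbOp ρ β ℓ h U) ^ 2 := by
    intro U
    unfold scanOp
    rw [mul_pow]
    have hcs := sq_sum_le_card_mul_sum_sq (s := (Finset.univ : Finset (Edge d L)))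
      (f := fun ℓ => hbOp ρ β ℓ h U)
    rw [Finset.card_univ] at hcs
    calc (Fintype.card (Edge d L) : ℝ)⁻¹ ^ 2 * (∑ ℓ, hbOp ρ β ℓ h U) ^ 2
        ≤ (Fintype.card (Edge d L) : ℝ)⁻¹ ^ 2 *
            ((Fintype.card (Edge d L) : ℝ) * ∑ ℓ, (hbOp ρ β ℓ h U) ^ 2) :=
          mul_le_mul_of_nonneg_left hcs (by positivity)
      _ = (Fintype.card (Edge d L) : ℝ)⁻¹ * ∑ ℓ, (hbOp ρ β ℓ h U) ^ 2 := by
          field_simp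
  -- (2) integrate (1) and use `∫ (E_ℓ h)² = ∫ h E_ℓ h`
  have hsqi : ∀ ℓ, Integrable (fun U => (hbOp ρ β ℓ h U) ^ 2)
      (wilsonMeasure (d := d) (L := L) ρ β) := fun ℓ =>
    integrable_of_measurable_of_abs_le ((measurable_hbOp ρ β hρ ℓ hh).pow_const 2)
      (fun V => abs_sq_le_sq (abs_hbOp_le ρ β hρ ℓ hM V))
  have hstep2 : ∫ U, (scanOp ρ β h U) ^ 2 ∂(wilsonMeasure (d := d) (L := L) ρ β) ≤
      (Fintype.card (Edge d L) : ℝ)⁻¹ *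
        ∑ ℓ, ∫ U, h U * hbOp ρ β ℓ h U ∂(wilsonMeasure (d := d) (L := L) ρ β) := by
    calc ∫ U, (scanOp ρ β h U) ^ 2 ∂(wilsonMeasure (d := d) (L := L) ρ β)
        ≤ ∫ U, (Fintype.card (Edge d L) : ℝ)⁻¹ * ∑ ℓ, (hbOp ρ β ℓ h U) ^ 2
            ∂(wilsonMeasure (d := d) (L := L) ρ β) :=
          integral_mono_of_nonneg (ae_of_all _ fun U => sq_nonneg _)
            ((integrable_finsetSum _ fun ℓ _ => hsqi ℓ).const_mul _) (ae_of_all _ hJ)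
      _ = (Fintype.card (Edge d L) : ℝ)⁻¹ *
            ∑ ℓ, ∫ U, (hbOp ρ β ℓ h U) ^ 2 ∂(wilsonMeasure (d := d) (L := L) ρ β) := by
          rw [integral_const_mul, integral_finsetSum _ fun ℓ _ => hsqi ℓ]
      _ = _ := by
          congr 1
          exact Finset.sum_congr rfl fun ℓ _ => integral_hbOp_sq ρ β hρ ℓ hh hM
  -- (3) the Poincaré inequality for `h`
  have hvar : variance h (wilsonMeasure (d := d) (L := L) ρ β) =
      ∫ U, (h U) ^ 2 ∂(wilsonMeasure (d := d) (L := L) ρ β) := by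
    have hmem : MemLp h 2 (wilsonMeasure (d := d) (L := L) ρ β) :=
      MemLp.of_bound hh.aestronglyMeasurable M
        (ae_of_all _ fun U => by rw [Real.norm_eq_abs]; exact hM U)
    rw [variance_eq_sub hmem, h0]
    simp only [Pi.pow_apply]
    ring
  have hPh := hP h hh ⟨M, hM⟩
  rw [hvar] at hPh
  simp only [integral_integral_sq_sub ρ β hρ _ hh hM, Finset.sum_sub_distrib, Finset.sum_const,
    Finset.card_univ, nsmul_eq_mul, ← Finset.mul_sum] at hPh
  -- (4) algebra
  set n : ℝ := (Fintype.card (Edge d L) : ℝ) with hn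
  set V : ℝ := ∫ U, (h U) ^ 2 ∂(wilsonMeasure (d := d) (L := L) ρ β) with hV
  set S : ℝ := ∑ ℓ : Edge d L, ∫ U, h U * hbOp ρ β ℓ h U ∂(wilsonMeasure (d := d) (L := L) ρ β)
    with hS
  have hS_le : 2 * C * S ≤ 2 * C * n * V - V := by linarith
  have h2Cn : 0 < 2 * C * n := by positivity
  calc ∫ U, (scanOp ρ β h U) ^ 2 ∂(wilsonMeasure (d := d) (L := L) ρ β) ≤ n⁻¹ * S := hstep2
    _ = (2 * C * S) / (2 * C * n) := by field_simp
    _ ≤ (2 * C * n * V - V) / (2 * C * n) := div_le_div_of_nonneg_right hS_le h2Cn.le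
    _ = (1 - (2 * C * n)⁻¹) * V := by field_simp

/-! ### Iterates of the random scan -/

/-- `K^j h` is measurable. [folklore] -/
theorem measurable_scanIter (hρ : Continuous ρ) {h : GaugeConfig d L G → ℝ} (hh : Measurable h)
    (j : ℕ) : Measurable (scanIter ρ β j h) := by
  induction j with
  | zero => exact hh
  | succ j ih => rw [scanIter_succ]; exact measurable_scanOp ρ β hρ ih

/-- Sup bound: `|K^j h| ≤ M` if `|h| ≤ M`. [folklore] -/
theorem abs_scanIter_le (hρ : Continuous ρ) {h : GaugeConfig d L G → ℝ} {M : ℝ}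
    (hM : ∀ V, |h V| ≤ M) (j : ℕ) (U : GaugeConfig d L G) : |scanIter ρ β j h U| ≤ M := by
  induction j generalizing U with
  | zero => exact hM U
  | succ j ih => rw [scanIter_succ]; exact abs_scanOp_le ρ β hρ ih U

/-- DLR for the iterates: `∫ K^j h dμ = ∫ h dμ`. [folklore] -/
theorem integral_scanIter [NeZero d] (hρ : Continuous ρ) {h : GaugeConfig d L G → ℝ}
    (hh : Measurable h) {M : ℝ} (hM : ∀ V, |h V| ≤ M) (j : ℕ) :
    ∫ U, scanIter ρ β j h U ∂(wilsonMeasure (d := d) (L := L) ρ β) =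
      ∫ U, h U ∂(wilsonMeasure (d := d) (L := L) ρ β) := by
  induction j with
  | zero => rfl
  | succ j ih =>
    simp only [scanIter_succ]
    rw [integral_scanOp ρ β hρ (measurable_scanIter ρ β hρ hh j) (abs_scanIter_le ρ β hρ hM j), ih]

/-- **Geometric `L²` decay of the random-scan heat bath** under the Poincaré inequality:
`∫ (K^j h)² dμ ≤ (1 − (2C|E|)⁻¹)^j ∫ h² dμ` for bounded measurable centred `h`
(Martinelli 1999 §3: spectral gap ⇒ exponential decay in `L²`). [folklore] -/
theorem integral_sq_scanIter_le [NeZero d] (hρ : Continuous ρ) {C : ℝ} (hC : 0 < C)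
    (hCn : 1 ≤ 2 * C * Fintype.card (Edge d L))
    (hP : ∀ F : GaugeConfig d L G → ℝ, Measurable F → (∃ M : ℝ, ∀ U, |F U| ≤ M) →
      variance F (wilsonMeasure (d := d) (L := L) ρ β) ≤
        C * ∑ ℓ : Edge d L, ∫ U, ∫ g, (F U - F (Function.update U ℓ g)) ^ 2 ∂(hbLaw ρ β ℓ U)
          ∂(wilsonMeasure (d := d) (L := L) ρ β))
    {h : GaugeConfig d L G → ℝ} (hh : Measurable h) {M : ℝ} (hM : ∀ V, |h V| ≤ M)
    (h0 : ∫ U, h U ∂(wilsonMeasure (d := d) (L := L) ρ β) = 0) (j : ℕ) :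
    ∫ U, (scanIter ρ β j h U) ^ 2 ∂(wilsonMeasure (d := d) (L := L) ρ β) ≤
      (1 - (2 * C * Fintype.card (Edge d L))⁻¹) ^ j *
        ∫ U, (h U) ^ 2 ∂(wilsonMeasure (d := d) (L := L) ρ β) := by
  induction j with
  | zero => simp [scanIter_zero]
  | succ j ih =>
    simp only [scanIter_succ]
    rw [pow_succ', mul_assoc]
    refine (integral_sq_scanOp_le ρ β hρ hC hP (measurable_scanIter ρ β hρ hh j)
      (abs_scanIter_le ρ β hρ hM j) ?_).trans ?_
    · rw [integral_scanIter ρ β hρ hh hM, h0]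
    · exact mul_le_mul_of_nonneg_left ih (sub_nonneg.2 (inv_le_one_of_one_le₀ hCn))

end Gap

end Summit.QuantumFields.YangMills.Theorems.PoincareClustering

end
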